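/-
Copyright (c) 2026 the pub-hodgecm-mathlib formalisation cell (harness21).  Prover seat hodgecm-mathlib-K2Liu-p05 (g8), Track B «K2-LIT»,
#184♮ = hLiu418 = `stmt-HodgeConjecture-24832`; #42F′ FACE-G organ F4 (G-gen), B3-b: the ONE-PLACE LETTER `hψ` of ★ (D-let) `K2LiuArchSWDataDerivLetters` DISCHARGED at
the junction frames of record (F4 desk K2Liu-p27 (g2) GO + FRAMES-OF-RECORD ruling 2026-09-05T00:19:48Z; consumer LH7-p07 (g2) `K2LiuArchSWDataInductionFinal`).
THEOREMS ONLY (no `def`, no `instance`, no notation, no local instance, no named-fact hypothesis, no `sorry`); lane `--supports stmt-HodgeConjecture-24832 --as helper`.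
-/
import Summits.HodgeConjecture.HodgeConjecture.Theorems.K2LiuArchJunctionFrameData            -- ★ `hsec_placeSec_relabel` (the (J2⊗-arch) identity at the junction frames)
import Summits.HodgeConjecture.HodgeConjecture.Theorems.K2LiuSwSectionTensorArchOrbitDeriv     -- ★ F2: `hasDerivAt_coe_detChar_archExp` (+ ★ `exists_archSkew_archExp_eq_placeSecJ_expMem`)
import HarnessLib

/-!
# Crux `HLiu418`, FACE-G organ F4 (G-gen), B3-b: the one-place letter `hψ` of ★ (D-let) at the JUNCTION FRAMES OF RECORD — `ψ_σ := placeSec_𝔻 σ ∘ relabel (eSp σ, eSq σ)`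
# with its (J2⊗-arch) identity (★ `hsec_placeSec_relabel`), and for every `Y ∈ 𝔲(2,2)` the letter `X ∈ archSkew`, the curve identity and the `detChar` derivative

Cell `hodgecm-mathlib`, crux item hLiu418 = `stmt-HodgeConjecture-24832`; squad K2 ∕ K2Liu; prover K2Liu-p05 (g8); F4 desk K2Liu-p27 (g2) (FRAMES OF RECORD
2026-09-05T00:19:48Z: `R σ := PosIdx (y σ)`, `S σ := NegIdx (y σ)`, `(eP σ, eQ σ) := (eP₀ σ)⁻¹ ≫ ((eSp σ)⁻¹ × 1 ⊕ (eSq σ)⁻¹ × 1)` = the output of ★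
`K2LiuArchJunctionFrameData.exists_junctionFrameData` with the small block frames `eSp σ : Fin 2 ≃ 𝔻⁺_σ`, `eSq σ : Fin 2 ≃ 𝔻⁻_σ` of ★ `exists_signFrame_two`), consumer
LH7-p07 (g2) (`K2LiuArchSWDataInductionFinal`, which `obtain`s the frame data ONCE).
* **`onePlaceLetter_of_junctionFrames (hα : Continuous α) (y hy hz eP₀ eQ₀ hE eSp eSq)`** — the hypothesis `hψ` of ★ (D-let)
  `K2LiuArchSWDataDerivLetters.hDXp_of_onePlaceLetter ∕ hDXm_of_onePlaceLetter` AT THESE FRAMES: for every real `σ`, `ψ_σ := placeSec_𝔻 σ ∘ UForm.relabel (eSp σ) (eSq σ)`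
  satisfies (a) `tensorEmb (archEmb (ψ_σ h)) = archEmb (placeSecJ_𝕎 σ (eP σ) (eQ σ) (toBig (h, 1), 1))` (★ `hsec_placeSec_relabel`, by name) and (b) for every `Y`, ★
  `exists_archSkew_archExp_eq_placeSecJ_expMem` at the frames `((eSp σ)⁻¹, (eSq σ)⁻¹)` gives `X ∈ archSkew` with `archExp hX s = archEmb (placeSecJ_𝔻 σ (exp sY, 1))
  = archEmb (ψ_σ (exp sY))` (★ `placeSecJ_inl` + `relabel_symm_symm_apply`, §1) and ★ F2 `hasDerivAt_coe_detChar_archExp hα` the derivative `c_X` of the `detChar α` leg.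
So in the Final: `hDXp := hDXp_of_onePlaceLetter … (R := fun σ => PosIdx (y σ)) (S := fun σ => NegIdx (y σ)) … ht hodd (onePlaceLetter_of_junctionFrames … hα y hy hz eP₀ eQ₀ hE eSp eSq)`.
References: [KonnoKonno2007, §3.1 (3.1)]; [Kudla1994, §2]; [BorelJacquet1979, §4.1]; [Varadarajan1984, Thm. 2.10.1, 2.11.2]; [GelbartRogawski1991, §3.1 Remark p. 457].
HONEST LABEL.  Count-neutral helper: `HC_CM` is proved only modulo the 7 printed citations (2 remaining named inputs: hLiu418 = `stmt-HodgeConjecture-24832`,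
h413 = `stmt-HodgeConjecture-24833`) until rung 0 closes; this file closes no socket.
-/

set_option autoImplicit false
set_option linter.dupNamespace false -- the mandated namespace repeats `HodgeConjecture.HodgeConjecture`

noncomputable section
open scoped Classical Matrix TensorProduct Kronecker SchwartzMap MatrixGroups
open NumberField NumberField.InfinitePlace NumberField.mixedEmbedding IsDedekindDomain
open Literature.Analysis.SegalBargmann Literature.Analysis.Distribution Literature.RepresentationTheory.HeisenbergGroup
open Literature.NumberTheory.Automorphic Literature.NumberTheory.Automorphic.UnitaryGroup Literature.NumberTheory.GaloisRepresentations
open Literature.NumberTheory.Weil1964 Literature.NumberTheory.Weil1964.MpS Literature.NumberTheory.Weil1964.UnitaryWeil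
open Literature.RepresentationTheory.HarrisKudlaSweet1996
open Literature.RepresentationTheory.KonnoKonno2007 hiding LetterKind letterOf letterGen letterOf_boost letterOf_torus letterOf_torus_eq
  letterGen_boost letterGen_torus letterGen_mem_lie exp_smul_letterGen
open Literature.RepresentationTheory.KonnoKonno2007.RealDualPair Literature.NumberTheory.K2Lit.SiegelDoubled
open Literature.NumberTheory.GelbartRogawski1991 Literature.NumberTheory.GelbartRogawski1991.GRConstruction Literature.NumberTheory.GelbartRogawski1991.UnitaryDualPair
open Literature.NumberTheory.GelbartRogawski1991.UnitaryDualPair.LocalSplitting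
open Summit.HodgeConjecture.HodgeConjecture.Cruxes.HLiu418.K2LiuArchSectionPlaceBlock
open Summit.HodgeConjecture.HodgeConjecture.Cruxes.HLiu418 (K2LiuArchOneParameterOrbitDefs.archEmb K2LiuArchOneParameterOrbitDefs.archExp)
open Summit.HodgeConjecture.HodgeConjecture.Cruxes.HLiu418.K2LiuSwSectionArchOrbit (exists_archSkew_archExp_eq_placeSecJ_expMem)
open Summit.HodgeConjecture.HodgeConjecture.Cruxes.HLiu418.K2LiuArchJunctionFrameData (hsec_placeSec_relabel)
open Summit.HodgeConjecture.HodgeConjecture.Cruxes.HLiu418.K2LiuSwSectionTensorArchOrbitDeriv (hasDerivAt_coe_detChar_archExp)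

namespace Summit.HodgeConjecture.HodgeConjecture.Cruxes.HLiu418.K2LiuArchSWDataOnePlaceLetter

/-! ## §1 Relabelling back and forth -/

/-- `(relabel e₁⁻¹ e₂⁻¹)⁻¹ g = relabel e₁ e₂ g` in `U(α, β) ≃ U(α′, β′)` (both have matrix `reindex (e₁ ⊕ e₂) (e₁ ⊕ e₂) g`, ★ `UForm.coe_relabel`). [cite: KonnoKonno2007, §3.1] -/
theorem relabel_symm_symm_apply {α β α' β' : Type} [Fintype α] [DecidableEq α] [Fintype β] [DecidableEq β] [Fintype α'] [DecidableEq α'] [Fintype β'] [DecidableEq β']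
    (e₁ : α ≃ α') (e₂ : β ≃ β') (g : UForm α β) :
    (UForm.relabel α' β' α β e₁.symm e₂.symm).symm g = UForm.relabel α β α' β' e₁ e₂ g := by
  rw [ContinuousMulEquiv.symm_apply_eq]
  refine Subtype.ext (Units.ext ?_)
  rw [UForm.coe_relabel, UForm.coe_relabel]
  ext i j
  simp only [Matrix.reindex_apply, Matrix.submatrix_apply, Equiv.sumCongr_symm, Equiv.symm_symm, Equiv.sumCongr_apply]
  rcases i with i | i <;> rcases j with j | j <;> simp

variable (L : Type) [Field L] [NumberField L] [IsCMField L]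
variable {N M n : ℕ} (e : Fin N × Fin M ≃ Fin n)
  (dV : Fin N → L) (hdV : ∀ i, IsCMField.complexConj L (dV i) = dV i) (hdV0 : ∀ i, dV i ≠ 0)
  (dW : Fin M → L) (hdW : ∀ i, IsCMField.complexConj L (dW i) = dW i) (hdW0 : ∀ i, dW i ≠ 0)
variable {M₂ M' n' : ℕ} (eW : Fin M × Fin M₂ ≃ Fin M') (e' : Fin N × Fin M' ≃ Fin n')
  (dV' : Fin M₂ → L) (hdV' : ∀ k, IsCMField.complexConj L (dV' k) = dV' k) (hdV'0 : ∀ k, dV' k ≠ 0)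
  (α : UnitaryGroup.adelicOne (Fp L) L (IsCMField.complexConj L) →* ℂˣ)

-- the CM sign frames of both data elaborate slowly (as ★ `K2LiuArchJunctionFrameData`: 4 000 000 heartbeats on the statement)
set_option maxHeartbeats 4000000

/-! ## §2 The one-place letter at the junction frames of record -/

include hdV0 hdW0 hdV'0 in
/-- **THE ONE-PLACE LETTER `hψ` OF ★ (D-let) AT THE JUNCTION FRAMES OF RECORD.**  See the module docstring.
[cite: KonnoKonno2007, §3.1 (3.1)] [cite: Kudla1994, §2] [cite: BorelJacquet1979, §4.1] [cite: Varadarajan1984, Thm. 2.10.1, Thm. 2.11.2] [cite: GelbartRogawski1991, §3.1 Remark p. 457] -/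
theorem onePlaceLetter_of_junctionFrames (hα : Continuous α)
    (y : {v : InfinitePlace (Fp L) // v.IsReal} → Fin M₂ → ℝ) (hy : ∀ σ k, y σ k ≠ 0)
    (hz : ∀ (σ : {v : InfinitePlace (Fp L) // v.IsReal}) j, (signVec (cmPlaceOver L) (fun k => Sum.elim (cmGramEntry L e' dV hdV (tensorFrame L dW eW dV') (tensorFrame_real L dW hdW eW dV' hdV')) (-cmGramEntry L e' dV hdV (tensorFrame L dW eW dV') (tensorFrame_real L dW hdW eW dV' hdV')) ((LocalSplitting.e₂ n').symm k)) (imagUnit L) σ) j = (signVec (cmPlaceOver L) (fun k => Sum.elim (cmGramEntry L e dV hdV dW hdW) (-cmGramEntry L e dV hdV dW hdW) ((LocalSplitting.e₂ n).symm k)) (imagUnit L) σ) ((epsD e eW e').symm j).1 * y σ ((epsD e eW e').symm j).2)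
    (eP₀ : ∀ σ : {v : InfinitePlace (Fp L) // v.IsReal}, (PosIdx (signVec (cmPlaceOver L) (fun k => Sum.elim (cmGramEntry L e dV hdV dW hdW) (-cmGramEntry L e dV hdV dW hdW) ((LocalSplitting.e₂ n).symm k)) (imagUnit L) σ) × PosIdx (y σ)) ⊕ (NegIdx (signVec (cmPlaceOver L) (fun k => Sum.elim (cmGramEntry L e dV hdV dW hdW) (-cmGramEntry L e dV hdV dW hdW) ((LocalSplitting.e₂ n).symm k)) (imagUnit L) σ) × NegIdx (y σ)) ≃ PosIdx (signVec (cmPlaceOver L) (fun k => Sum.elim (cmGramEntry L e' dV hdV (tensorFrame L dW eW dV') (tensorFrame_real L dW hdW eW dV' hdV')) (-cmGramEntry L e' dV hdV (tensorFrame L dW eW dV') (tensorFrame_real L dW hdW eW dV' hdV')) ((LocalSplitting.e₂ n').symm k)) (imagUnit L) σ))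
    (eQ₀ : ∀ σ : {v : InfinitePlace (Fp L) // v.IsReal}, (PosIdx (signVec (cmPlaceOver L) (fun k => Sum.elim (cmGramEntry L e dV hdV dW hdW) (-cmGramEntry L e dV hdV dW hdW) ((LocalSplitting.e₂ n).symm k)) (imagUnit L) σ) × NegIdx (y σ)) ⊕ (NegIdx (signVec (cmPlaceOver L) (fun k => Sum.elim (cmGramEntry L e dV hdV dW hdW) (-cmGramEntry L e dV hdV dW hdW) ((LocalSplitting.e₂ n).symm k)) (imagUnit L) σ) × PosIdx (y σ)) ≃ NegIdx (signVec (cmPlaceOver L) (fun k => Sum.elim (cmGramEntry L e' dV hdV (tensorFrame L dW eW dV') (tensorFrame_real L dW hdW eW dV' hdV')) (-cmGramEntry L e' dV hdV (tensorFrame L dW eW dV') (tensorFrame_real L dW hdW eW dV' hdV')) ((LocalSplitting.e₂ n').symm k)) (imagUnit L) σ))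
    (hE : ∀ (σ : {v : InfinitePlace (Fp L) // v.IsReal}) i, (dpEquiv _ _ _ _).symm (((eP₀ σ).sumCongr (eQ₀ σ)).symm i) =
      (signSplit (signVec (cmPlaceOver L) (fun k => Sum.elim (cmGramEntry L e dV hdV dW hdW) (-cmGramEntry L e dV hdV dW hdW) ((LocalSplitting.e₂ n).symm k)) (imagUnit L) σ) ((epsD e eW e').symm ((signSplit (signVec (cmPlaceOver L) (fun k => Sum.elim (cmGramEntry L e' dV hdV (tensorFrame L dW eW dV') (tensorFrame_real L dW hdW eW dV' hdV')) (-cmGramEntry L e' dV hdV (tensorFrame L dW eW dV') (tensorFrame_real L dW hdW eW dV' hdV')) ((LocalSplitting.e₂ n').symm k)) (imagUnit L) σ)).symm i)).1, signSplit (y σ) ((epsD e eW e').symm ((signSplit (signVec (cmPlaceOver L) (fun k => Sum.elim (cmGramEntry L e' dV hdV (tensorFrame L dW eW dV') (tensorFrame_real L dW hdW eW dV' hdV')) (-cmGramEntry L e' dV hdV (tensorFrame L dW eW dV') (tensorFrame_real L dW hdW eW dV' hdV')) ((LocalSplitting.e₂ n').symm k)) (imagUnit L) σ)).symm i)).2)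)
    (eSp : ∀ σ : {v : InfinitePlace (Fp L) // v.IsReal}, Fin 2 ≃ PosIdx (signVec (cmPlaceOver L) (fun k => Sum.elim (cmGramEntry L e dV hdV dW hdW) (-cmGramEntry L e dV hdV dW hdW) ((LocalSplitting.e₂ n).symm k)) (imagUnit L) σ)) (eSq : ∀ σ : {v : InfinitePlace (Fp L) // v.IsReal}, Fin 2 ≃ NegIdx (signVec (cmPlaceOver L) (fun k => Sum.elim (cmGramEntry L e dV hdV dW hdW) (-cmGramEntry L e dV hdV dW hdW) ((LocalSplitting.e₂ n).symm k)) (imagUnit L) σ)) :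
    letI : LieRing (Matrix (Fin 2 ⊕ Fin 2) (Fin 2 ⊕ Fin 2) ℂ) := LieRing.ofAssociativeRing
    ∀ σ : {v : InfinitePlace (Fp L) // v.IsReal}, ∃ ψ : UForm (Fin 2) (Fin 2) →* UnitaryGroup.arch (Fp L) L (IsCMField.complexConj L) (n + n) (hermD L e dV hdV dW hdW),
      (∀ h : UForm (Fin 2) (Fin 2),
        tensorEmb L e dV hdV dW hdW eW e' dV' hdV' (K2LiuArchOneParameterOrbitDefs.archEmb (Fp L) L (IsCMField.complexConj L) (n + n) (hermD L e dV hdV dW hdW) (ψ h)) =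
          K2LiuArchOneParameterOrbitDefs.archEmb (Fp L) L (IsCMField.complexConj L) (n' + n') (hermD L e' dV hdV (tensorFrame L dW eW dV') (tensorFrame_real L dW hdW eW dV' hdV'))
            ((placeSecJ L (IsCMField.complexConj L) (n' + n') (IsCMField.complexConj_ne_one L) (cmPlaceOver L) (cmPlaceOver_smul L) _ (gramD_gram_realDiagonal_entry_ne_zero L e' dV hdV (tensorFrame L dW eW dV') (tensorFrame_real L dW hdW eW dV' hdV') hdV0 (tensorFrame_ne_zero L dW eW dV' hdW0 hdV'0)) (complexConj_imagUnit L)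
            (imagUnit_ne_zero L) σ (cmPlaceOver_comap L) (gramD_eq_diagonal_cm L e' dV hdV (tensorFrame L dW eW dV') (tensorFrame_real L dW hdW eW dV' hdV')) (J := hermD L e' dV hdV (tensorFrame L dW eW dV') (tensorFrame_real L dW hdW eW dV' hdV')) rfl (complexConj_smul_infinitePlace L)
            ((eP₀ σ).symm.trans (Equiv.sumCongr ((eSp σ).symm.prodCongr (Equiv.refl (PosIdx (y σ)))) ((eSq σ).symm.prodCongr (Equiv.refl (NegIdx (y σ)))))) ((eQ₀ σ).symm.trans (Equiv.sumCongr ((eSp σ).symm.prodCongr (Equiv.refl (NegIdx (y σ)))) ((eSq σ).symm.prodCongr (Equiv.refl (PosIdx (y σ))))))) ((toBig (Fin 2) (Fin 2) (PosIdx (y σ)) (NegIdx (y σ)) (h, 1), (1 : UForm Unit Empty)) : Ginf ((Fin 2 × PosIdx (y σ)) ⊕ (Fin 2 × NegIdx (y σ))) ((Fin 2 × NegIdx (y σ)) ⊕ (Fin 2 × PosIdx (y σ))) Unit Empty))) ∧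
      ∀ Y : ↥(uFormGroup (Fin 2) (Fin 2)).lie.toSubmodule, ∃ (X : Matrix (Fin (n + n)) (Fin (n + n)) (mixedSpace L)) (hX : X ∈ archSkew (Fp L) L (IsCMField.complexConj L) (n + n) (hermD L e dV hdV dW hdW)) (c : ℂ),
        (∀ s : ℝ, K2LiuArchOneParameterOrbitDefs.archExp (Fp L) L (IsCMField.complexConj L) (n + n) (hermD L e dV hdV dW hdW) hX s = K2LiuArchOneParameterOrbitDefs.archEmb (Fp L) L (IsCMField.complexConj L) (n + n) (hermD L e dV hdV dW hdW) (ψ ((uFormGroup (Fin 2) (Fin 2)).expMem ⟨((s • Y : ↥(uFormGroup (Fin 2) (Fin 2)).lie.toSubmodule) : Matrix (Fin 2 ⊕ Fin 2) (Fin 2 ⊕ Fin 2) ℂ), (s • Y).2⟩ : UForm (Fin 2) (Fin 2)))) ∧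
        HasDerivAt (fun t' : ℝ => ((((DoubledWeilDetTwist.detChar L e dV hdV hdV0 dW hdW hdW0 α) (K2LiuArchOneParameterOrbitDefs.archExp (Fp L) L (IsCMField.complexConj L) (n + n) (hermD L e dV hdV dW hdW) hX t')) : ℂˣ) : ℂ)) c 0 := by
  letI : LieRing (Matrix (Fin 2 ⊕ Fin 2) (Fin 2 ⊕ Fin 2) ℂ) := LieRing.ofAssociativeRing
  intro σ
  refine ⟨((placeSec L (IsCMField.complexConj L) (n + n) (IsCMField.complexConj_ne_one L) (cmPlaceOver L) (cmPlaceOver_smul L) _ (gramD_gram_realDiagonal_entry_ne_zero L e dV hdV dW hdW hdV0 hdW0) (complexConj_imagUnit L) (imagUnit_ne_zero L) σ (cmPlaceOver_comap L) (gramD_eq_diagonal_cm L e dV hdV dW hdW) (J := hermD L e dV hdV dW hdW) rfl (complexConj_smul_infinitePlace L)).comp (UForm.relabel (Fin 2) (Fin 2) (PosIdx (signVec (cmPlaceOver L) (fun k => Sum.elim (cmGramEntry L e dV hdV dW hdW) (-cmGramEntry L e dV hdV dW hdW) ((LocalSplitting.e₂ n).symm k)) (imagUnit L) σ)) (NegIdx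 (signVec (cmPlaceOver L) (fun k => Sum.elim (cmGramEntry L e dV hdV dW hdW) (-cmGramEntry L e dV hdV dW hdW) ((LocalSplitting.e₂ n).symm k)) (imagUnit L) σ)) (eSp σ) (eSq σ)).toMonoidHom), hsec_placeSec_relabel L e dV hdV hdV0 dW hdW hdW0 eW e' dV' hdV' hdV'0 σ (y σ) (hy σ) (hz σ) (eP₀ σ) (eQ₀ σ) (hE σ) (eSp σ) (eSq σ), fun Y => ?_⟩
  obtain ⟨X, hX, hcurve, -⟩ := exists_archSkew_archExp_eq_placeSecJ_expMem L e dV hdV hdV0 dW hdW hdW0 σ (eSp σ).symm (eSq σ).symm Y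
  refine ⟨X, hX, _, fun s => ?_, hasDerivAt_coe_detChar_archExp L e dV hdV hdV0 dW hdW hdW0 σ (eSp σ).symm (eSq σ).symm Y hX hcurve α hα⟩
  rw [hcurve s, placeSecJ_inl, MonoidHom.comp_apply, relabel_symm_symm_apply]
  rfl

end Summit.HodgeConjecture.HodgeConjecture.Cruxes.HLiu418.K2LiuArchSWDataOnePlaceLetter

end
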